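import Literature.Barriers.ABC.BakerMethodBoundsProofs
import Literature.NumberTheory.DiophantineGeometry.AbcWave0BakerWustholzProofs
import HarnessLib

/-!
# Pasten's Theorem 1.4 (1) from Baker–Wüstholz 1993 and Theorem 2.5 alone (proofs)

Second proofs companion of `BakerMethodBounds.lean` for the named fact
`Literature.Barriers.ABC.pasten2024_thm_1_4_1` (H. Pasten, *The largest prime factor of
`n² + 1` and improvements on subexponential `ABC`*, Invent. Math. 236 (2024), 373–385,
Theorem 1.4 (1) [cite: Pasten2024, Theorem 1.4 (1)]: an absolute `κ > 0` with
`log c ≤ η⁻¹ exp(κ √((log R) log₂ R))` whenever `a ≤ c^{1−η}`). Theorems only; no definition,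
no new named fact.

`BakerMethodBoundsProofs.lean` proves the printed deduction of §4,
`pasten2024_thm_1_4_1_of_facts : evertseGyory_thm_4_2_1_rat → pasten2024_thm_2_5 → …`, whose
first input (Evertse–Győry, Thm 4.2.1 over `ℚ`) packages Matveev's archimedean AND Yu's
`p`-adic lower bounds for linear forms in logarithms. This file PROVES that a smaller trust
base suffices:

`pasten2024_thm_1_4_1_of_bakerWustholz : baker_wustholz ℚ → pasten2024_thm_2_5 → pasten2024_thm_1_4_1`,

where `Literature.NumberTheory.DiophantineGeometry.baker_wustholz ℚ` is the tree's record of the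
purely ARCHIMEDEAN theorem of Baker–Wüstholz (J. reine angew. Math. 442 (1993), Theorem =
Baker–Wüstholz 2007, Thm 7.1 [cite: BakerWustholz2007, Thm 7.1]) over `K = ℚ`:
`log |Λ| > −C(n, 1) h'(α₁)⋯h'(αₙ) log(eB)`, `C(n, d) = 18 (n+1)! n^{n+1} (32d)^{n+2} log(2nd)`.
Two remarks make this possible, both inside the architecture of §4 (splitting
`b/c = ξ₀ ∏_{p ∈ I} p^{e_p}` at `B = exp s(R)`, `s(R) = √((log R) log₂ R)`, `#I · s ≤ 4 log R` by
Theorem 2.5, `h(ξ₀) ≤ B log R`):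

1. *Matveev's sharpening is not needed.* The source uses Theorem 2.1 (i) with the constant
   `K^m` (Matveev); but any constant `exp(O(m log m))` is still `exp(O(s))`, because
   `m − 1 = #I ≤ 4 √(log R / log₂ R)` and `log m ≤ ½ log₂ R + O(1)`:
   `log C(#I + 1, 1) ≤ 98 s(R)` (`log_bwConstant_le`, via `C(n, 1) ≤ (32(n+1))^{2n+4}`,
   `bwConstant_one_le_pow`).
2. *No exponential abc bound, hence no `p`-adic theory, is needed.* The only use of the
   exponential bound in §4 is `log h(b/c) ≪ log R`; but Theorem 2.5 alone gives
   `ν_p(c) ≤ ∏_{q ∣ abc} ν_q(abc) ≤ k₁ R³`, so `log c ≤ k₁ R³ log R ≤ k₁ R⁴` and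
   `log log c ≤ 5 log R` (`log_le_exponentProduct_mul_log_rad`,
   `loglog_le_of_exponentProduct_le`).

## Contents (all proved)

* `neg_log_abs_one_sub_le_of_pos`: `−log |1 − x| ≤ 1 + max(0, −log |log x|)` for `x > 0`,
  `x ≠ 1` (passage from the linear form `Λ = log x` to `1 − x`; `|1 − eᵗ| ≥ |t|/e` for `|t| ≤ 1`).
* `bakerWustholz_rat_of_pos`: `baker_wustholz ℚ` specialised to positive rationals `αᵢ` over
  any finite index type: `h'(α) = max(h(α), 1)` (`bwHeight_rat_of_pos`, as `|log α| ≤ h(α)`,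
  `abs_log_le_logHeight₁`), `Λ = ∑ eᵢ log αᵢ = log ∏ αᵢ^{eᵢ}` (principal logarithms of
  positive reals), so `log |log x| > −C(n, 1) ∏ max(h(αᵢ), 1) log(eB)` for `x = ∏ αᵢ^{eᵢ} ≠ 1`.
* `neg_log_abs_one_sub_div_le_of_bakerWustholz`: on Pasten's splitting of `u/v` (index type
  `Option ↥I`: coefficient `1` on `ξ₀`, `e_p` on `p ∈ I`; `B ≤ log(uv)/log 2` since
  `2^{|e_p|} ≤ p^{|e_p|} ≤ uv`):
  `−log |1 − u/v| ≤ 1 + C(#I+1, 1) · max(h(ξ₀), 1) ∏_{p ∈ I} max(log p, 1) · (1 + log(log(uv)/log 2))`.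
* the accounting lemmas of remarks 1–2, `bwHeights_le`, `coeffTerm_le`, and the assembly
  `pasten2024_thm_1_4_1_of_bakerWustholz` (`κ = 113`, threshold `log R ≥ max(e, log k₁)`).

The discharge `pasten2024_thm_1_4_1_holds` thus needs exactly `baker_wustholz ℚ` (whose case
`n = 1` is proved in `AbcWave0BakerWustholzProofs.lean`; the general case is the Baker–Wüstholz
theory) and `pasten2024_thm_2_5` (Shimura curves and modularity); neither is in Mathlib.

## References

* [Pasten2024] H. Pasten, Invent. Math. 236 (2024), 373–385, doi:10.1007/s00222-024-01244-6,
  arXiv:2312.03566 — Theorem 1.4 (1) (§1), Theorems 2.1, 2.5 (§2), §4.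
* [BakerWustholz2007] A. Baker, G. Wüstholz, *Logarithmic Forms and Diophantine Geometry*, New
  Math. Monogr. 9, CUP 2007 — Thm 7.1 (PDF pp. 125–126); §7.2 p. 127 on Matveev's `c^n`.
* [BakerWustholz1993] A. Baker, G. Wüstholz, *Logarithmic forms and group varieties*, J. reine
  angew. Math. 442 (1993), 19–62 — main Theorem.
* [PastenShimura2024] H. Pasten, *Shimura curves and the abc conjecture*, J. Number Theory 254
  (2024), 214–335 — Theorem 16.8 (= Theorem 2.5 here).
-/

noncomputable section

open Finset Real Height
open Literature.NumberTheory.DiophantineGeometry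
open Literature.NumberTheory.DiophantineGeometry.Pasten

namespace Literature.Barriers.ABC

/-! ### From `|log x|` to `|1 − x|` -/

/-- For `|t| ≤ 1`: `|1 − eᵗ| ≥ |t| / e`. [folklore] -/
theorem abs_div_exp_one_le_abs_one_sub_exp {t : ℝ} (ht : |t| ≤ 1) :
    |t| / Real.exp 1 ≤ |1 - Real.exp t| := by
  have he : 0 < Real.exp 1 := Real.exp_pos 1
  rcases le_or_gt 0 t with h0 | h0
  · -- `eᵗ - 1 ≥ t ≥ t/e`
    rw [abs_of_nonneg h0, abs_sub_comm, abs_of_nonneg (by linarith [Real.add_one_le_exp t])]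
    have h1 : t / Real.exp 1 ≤ t := div_le_self h0 (by linarith [Real.add_one_le_exp (1 : ℝ)])
    linarith [Real.add_one_le_exp t]
  · -- `t = -u`, `0 < u ≤ 1`: `1 - e^{-u} = (e^u - 1)/e^u ≥ u / e^u ≥ u / e`
    have hu : 0 < -t := by linarith
    have hu1 : -t ≤ 1 := by rw [abs_of_neg h0] at ht; exact ht
    rw [abs_of_neg h0]
    have hexp : Real.exp t < 1 := Real.exp_lt_one_iff.mpr h0
    rw [abs_of_pos (by linarith)]
    -- `1 - exp t = (exp(-t) - 1) * exp t`, and `exp(-t) - 1 ≥ -t`, `exp t ≥ exp(-1)`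
    have h1 : Real.exp (-1) ≤ Real.exp t := Real.exp_le_exp.mpr (by linarith)
    have h2 : -t ≤ Real.exp (-t) - 1 := by linarith [Real.add_one_le_exp (-t)]
    have h3 : Real.exp (-t) * Real.exp t = 1 := by rw [← Real.exp_add]; simp
    have hpos : 0 < Real.exp t := Real.exp_pos t
    calc -t / Real.exp 1 = -t * Real.exp (-1) := by rw [Real.exp_neg, div_eq_mul_inv]
      _ ≤ (Real.exp (-t) - 1) * Real.exp t := by
          apply mul_le_mul h2 h1 (Real.exp_pos _).le
          linarith
      _ = 1 - Real.exp t := by rw [sub_mul, h3, one_mul]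

/-- For `x > 0`: `−log |1 − x| ≤ 1 + max 0 (−log |log x|)` (if `|log x| ≤ 1` then
`|1 − x| ≥ |log x|/e`; otherwise `|1 − x| ≥ 1/e`). [folklore] -/
theorem neg_log_abs_one_sub_le_of_pos {x : ℝ} (hx : 0 < x) (hx1 : x ≠ 1) :
    -Real.log |1 - x| ≤ 1 + max 0 (-Real.log |Real.log x|) := by
  have he : 0 < Real.exp 1 := Real.exp_pos 1
  have hlx : Real.log x ≠ 0 := Real.log_ne_zero_of_pos_of_ne_one hx hx1
  have habs : 0 < |Real.log x| := abs_pos.mpr hlx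
  rcases le_or_gt |Real.log x| 1 with h | h
  · have h1 : |Real.log x| / Real.exp 1 ≤ |1 - x| := by
      have := abs_div_exp_one_le_abs_one_sub_exp h
      rwa [Real.exp_log hx] at this
    have hpos : 0 < |Real.log x| / Real.exp 1 := div_pos habs he
    have h2 : Real.log (|Real.log x| / Real.exp 1) ≤ Real.log |1 - x| := Real.log_le_log hpos h1
    rw [Real.log_div habs.ne' he.ne', Real.log_exp] at h2
    have h3 : -Real.log |Real.log x| ≤ max 0 (-Real.log |Real.log x|) := le_max_right _ _
    linarith
  · -- `|log x| > 1`: `|1 - x| ≥ 1/e`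
    have h1 : (Real.exp 1)⁻¹ ≤ |1 - x| := by
      rcases lt_or_gt_of_ne hx1 with hlt | hgt
      · -- `x < 1`, `log x < -1`, `x < e⁻¹`, `1 - x > 1 - e⁻¹ ≥ e⁻¹`
        have hlog : Real.log x < -1 := by
          have : Real.log x < 0 := Real.log_neg hx hlt
          rw [abs_of_neg this] at h; linarith
        have hxe : x < (Real.exp 1)⁻¹ := by
          rw [← Real.exp_neg]
          calc x = Real.exp (Real.log x) := (Real.exp_log hx).symm
            _ < Real.exp (-1) := Real.exp_lt_exp.mpr hlog
        rw [abs_of_pos (by linarith)]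
        -- `e⁻¹ ≤ 1/2`
        have h2 : (Real.exp 1)⁻¹ ≤ 1 / 2 := by
          rw [inv_le_comm₀ he (by norm_num)]
          have := Real.add_one_le_exp (1 : ℝ); norm_num at this ⊢; linarith
        linarith
      · -- `x > 1`, `log x > 1`, `x > e`, `x - 1 > e - 1 ≥ 1 ≥ e⁻¹`
        have hlog : 1 < Real.log x := by
          have : 0 < Real.log x := Real.log_pos hgt
          rw [abs_of_pos this] at h; exact h
        have hxe : Real.exp 1 < x := by
          calc Real.exp 1 < Real.exp (Real.log x) := Real.exp_lt_exp.mpr hlog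
            _ = x := Real.exp_log hx
        rw [abs_of_neg (by linarith)]
        have h2 : (Real.exp 1)⁻¹ ≤ 1 := inv_le_one_of_one_le₀ (by linarith [Real.add_one_le_exp (1 : ℝ)])
        linarith [Real.add_one_le_exp (1 : ℝ)]
    have h2 : Real.log (Real.exp 1)⁻¹ ≤ Real.log |1 - x| := Real.log_le_log (inv_pos.mpr he) h1
    rw [Real.log_inv, Real.log_exp] at h2
    have h3 : 0 ≤ max 0 (-Real.log |Real.log x|) := le_max_left _ _
    linarith

/-! ### Baker–Wüstholz over `ℚ`, for positive rationals -/

section BWRat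

/-- `|log q| ≤ h(q)` for a positive rational `q` (`q = m/d` in lowest terms, `m, d ≥ 1`,
`|log m − log d| ≤ log max(m, d)`). [folklore] -/
theorem abs_log_le_logHeight₁ {q : ℚ} (hq : 0 < q) : |Real.log (q : ℝ)| ≤ logHeight₁ q := by
  rw [Rat.logHeight₁_eq_log_max]
  have hnum : 0 < q.num := Rat.num_pos.mpr hq
  have hden : 0 < q.den := q.den_pos
  have hq' : (q : ℝ) = (q.num : ℝ) / (q.den : ℝ) := Rat.cast_def q
  have hn1 : (1 : ℝ) ≤ q.num := by exact_mod_cast hnum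
  have hd1 : (1 : ℝ) ≤ q.den := by exact_mod_cast hden
  have hnabs : ((q.num.natAbs : ℕ) : ℝ) = (q.num : ℝ) := by
    rw [Nat.cast_natAbs, Int.cast_abs, abs_of_pos (by exact_mod_cast hnum)]
  rw [hq', Real.log_div (by positivity) (by positivity)]
  have hM : Real.log (q.num : ℝ) ≤ Real.log ((max q.num.natAbs q.den : ℕ) : ℝ) :=
    Real.log_le_log (by positivity) (by rw [← hnabs]; exact_mod_cast le_max_left _ _)
  have hD : Real.log (q.den : ℝ) ≤ Real.log ((max q.num.natAbs q.den : ℕ) : ℝ) :=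
    Real.log_le_log (by positivity) (by exact_mod_cast le_max_right _ _)
  have hn0 : 0 ≤ Real.log (q.num : ℝ) := Real.log_nonneg hn1
  have hd0 : 0 ≤ Real.log (q.den : ℝ) := Real.log_nonneg hd1
  rw [abs_le]; constructor <;> linarith

/-- The principal complex logarithm of a positive rational (through any `σ : ℚ →+* ℂ`, i.e. the
cast) is its real logarithm. [folklore] -/
theorem complex_log_ratCast_of_pos (σ : ℚ →+* ℂ) {q : ℚ} (hq : 0 < q) :
    Complex.log (σ q) = ((Real.log (q : ℝ) : ℝ) : ℂ) := by
  rw [eq_ratCast σ q, ← Complex.ofReal_ratCast, Complex.ofReal_log (by exact_mod_cast hq.le)]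

/-- Baker–Wüstholz's modified height over `K = ℚ` (`d = 1`) of a positive rational:
`h'(q) = max(h(q), |log q|, 1) = max(h(q), 1)`. [cite: BakerWustholz2007, §7.2 (PDF p. 125)] -/
theorem bwHeight_rat_of_pos (σ : ℚ →+* ℂ) {q : ℚ} (hq : 0 < q) :
    bwHeight σ q = max (logHeight₁ q) 1 := by
  rw [bwHeight, Module.finrank_self]
  simp only [Nat.cast_one, div_one]
  rw [complex_log_ratCast_of_pos σ hq, Complex.norm_real, Real.norm_eq_abs, ← max_assoc,
    max_eq_left (abs_log_le_logHeight₁ hq)]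

/-- **Baker–Wüstholz 1993 over `ℚ`, for positive rationals.** From the named fact
`baker_wustholz ℚ`: for positive rationals `α_i` (any finite index type, `n` of them), integers
`e_i`, and `x = ∏ α_i^{e_i} ≠ 1`, the linear form `Λ = ∑ e_i log α_i = log x ≠ 0` satisfies
`log |log x| > −C(n, 1) · ∏ max(h(α_i), 1) · log(e B)`, `B = max |e_i|`, `C = bwConstant`.
[cite: BakerWustholz2007, Thm 7.1] -/
theorem bakerWustholz_rat_of_pos (hBW : baker_wustholz ℚ) {ι : Type} [Fintype ι]
    (α : ι → ℚ) (e : ι → ℤ) (hpos : ∀ i, 0 < α i) {x : ℚ} (hx : ∏ i, α i ^ e i = x)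
    (hx1 : x ≠ 1) :
    -(bwConstant (Fintype.card ι) 1 * (∏ i, max (logHeight₁ (α i)) 1) *
        Real.log (Real.exp 1 * (Finset.univ.sup fun i ↦ (e i).natAbs : ℕ))) <
      Real.log |Real.log (x : ℝ)| := by
  classical
  set n := Fintype.card ι with hn
  set eqv : ι ≃ Fin n := Fintype.equivFin ι
  set σ : ℚ →+* ℂ := Rat.castHom ℂ
  have hα0 : ∀ j : Fin n, (α ∘ eqv.symm) j ≠ 0 := fun j => (hpos _).ne'
  have hxpos : (0 : ℝ) < x := by
    rw [← hx]; push_cast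
    exact Finset.prod_pos fun i _ => zpow_pos (by exact_mod_cast hpos i) _
  have hlogx : Real.log (x : ℝ) = ∑ i, (e i : ℝ) * Real.log (α i : ℝ) := by
    rw [← hx]; push_cast
    rw [Real.log_prod fun i _ => (zpow_pos (by exact_mod_cast hpos i) _).ne']
    exact Finset.sum_congr rfl fun i _ => Real.log_zpow _ _
  have hsum : ∑ j, ((e ∘ eqv.symm) j : ℂ) * Complex.log (σ ((α ∘ eqv.symm) j)) =
      ((Real.log (x : ℝ) : ℝ) : ℂ) := by
    simp only [Function.comp, complex_log_ratCast_of_pos σ (hpos _)]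
    rw [hlogx, ← Equiv.sum_comp eqv.symm (fun i => (e i : ℝ) * Real.log (α i : ℝ))]
    push_cast
    rfl
  have hΛ : ∑ j, ((e ∘ eqv.symm) j : ℂ) * Complex.log (σ ((α ∘ eqv.symm) j)) ≠ 0 := by
    rw [hsum]
    exact Complex.ofReal_ne_zero.mpr (Real.log_ne_zero_of_pos_of_ne_one hxpos
      (by exact_mod_cast hx1))
  have key := hBW σ (α ∘ eqv.symm) (e ∘ eqv.symm) hα0 hΛ
  rw [hsum, Complex.norm_real, Real.norm_eq_abs, Module.finrank_self] at key
  have hprod : ∏ j, bwHeight σ ((α ∘ eqv.symm) j) = ∏ i, max (logHeight₁ (α i)) 1 := by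
    change ∏ j, bwHeight σ (α (eqv.symm j)) = _
    rw [Equiv.prod_comp eqv.symm (fun i => bwHeight σ (α i))]
    exact Finset.prod_congr rfl fun i _ => bwHeight_rat_of_pos σ (hpos i)
  have hsup : (Finset.univ.sup fun j ↦ ((e ∘ eqv.symm) j).natAbs) =
      Finset.univ.sup fun i ↦ (e i).natAbs := by
    rw [← Finset.univ_map_equiv_to_embedding eqv.symm, Finset.sup_map]
    rfl
  rw [hprod, hsup] at key
  exact key

end BWRat

/-! ### The bound for `u/v` from Baker–Wüstholz, on Pasten's splitting -/

section Split

variable {u v : ℕ}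

/-- On any prime `p`: `|e_p| · log 2 ≤ log(uv)` (`2^{ν_p(uv)} ≤ p^{ν_p(uv)} ≤ uv`). [folklore] -/
theorem natAbs_expDiff_mul_log_two_le (hu : u ≠ 0) (hv : v ≠ 0) (huv : u.Coprime v) {p : ℕ}
    (hp : p.Prime) : ((expDiff u v p).natAbs : ℝ) * Real.log 2 ≤ Real.log ((u : ℝ) * v) := by
  rw [natAbs_expDiff hu hv huv p]
  have huv0 : u * v ≠ 0 := mul_ne_zero hu hv
  have h1 : p ^ (u * v).factorization p ≤ u * v := Nat.ordProj_le p huv0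
  have h2 : 2 ^ (u * v).factorization p ≤ p ^ (u * v).factorization p :=
    Nat.pow_le_pow_left hp.two_le _
  have h3 : (((2 ^ (u * v).factorization p : ℕ)) : ℝ) ≤ ((u * v : ℕ) : ℝ) := by
    exact_mod_cast h2.trans h1
  push_cast at h3
  rw [← Real.log_pow]
  exact Real.log_le_log (by positivity) h3

/-- **Baker–Wüstholz applied to the splitting of `u/v`** (the archimedean step of Pasten's §4
with Theorem 7.1 of Baker–Wüstholz in place of Evertse–Győry's Theorem 4.2.1): for coprime
positive `u, v` with `uv > 1` and any threshold `N`, writing `u/v = ξ₀ · ∏_{p ∈ I} p^{e_p}`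
(`I = bigPrimes u v N`, `ξ₀ = cofactor u v N`) and applying `baker_wustholz ℚ` to the `#I + 1`
numbers `ξ₀, p (p ∈ I)` with coefficients `1, e_p` (so `Λ = log(u/v) ≠ 0`, `B ≤ log(uv)/log 2`):
`−log |1 − u/v| ≤ 1 + C(#I+1, 1) · max(h(ξ₀), 1) · ∏_{p ∈ I} max(log p, 1) · (1 + log(log(uv)/log 2))`.
[cite: Pasten2024, §4] [cite: BakerWustholz2007, Thm 7.1] -/
theorem neg_log_abs_one_sub_div_le_of_bakerWustholz (hBW : baker_wustholz ℚ)
    (hu : u ≠ 0) (hv : v ≠ 0) (huv : u.Coprime v) (h1 : 1 < u * v) (N : ℕ) :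
    -Real.log |1 - (u : ℝ) / v| ≤
      1 + bwConstant ((bigPrimes u v N).card + 1) 1 *
        (max (logHeight₁ (cofactor u v N)) 1 *
          ∏ p ∈ bigPrimes u v N, max (Real.log p) 1) *
        (1 + Real.log (Real.log ((u : ℝ) * v) / Real.log 2)) := by
  classical
  set I := bigPrimes u v N with hI
  set ξ₀ := cofactor u v N with hξ₀
  set x : ℚ := (u : ℚ) / v with hxdef
  -- the family `ξ₀, p (p ∈ I)` with exponents `1, e_p`, indexed by `Option ↥I`
  set α : Option ↥I → ℚ := fun o => o.elim ξ₀ fun p => ((p : ℕ) : ℚ) with hα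
  set e : Option ↥I → ℤ := fun o => o.elim 1 fun p => expDiff u v p with he
  have hpos : ∀ o, 0 < α o := by
    rintro (_ | p)
    · exact cofactor_pos u v N
    · simp only [hα, Option.elim_some]
      exact_mod_cast (prime_of_mem_bigPrimes p.2).pos
  have hx : ∏ o, α o ^ e o = x := by
    rw [Fintype.prod_option]
    simp only [hα, he, Option.elim_none, Option.elim_some, zpow_one]
    rw [hxdef, cast_div_eq_cofactor_mul_prod hu hv huv N, ← Finset.prod_coe_sort I]
  have hx1 : x ≠ 1 := cast_div_ne_one hv huv h1
  have key := bakerWustholz_rat_of_pos hBW α e hpos hx hx1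
  -- identify the pieces
  have hcard : Fintype.card (Option ↥I) = I.card + 1 := by
    rw [Fintype.card_option, Fintype.card_coe]
  have hprod : ∏ o, max (logHeight₁ (α o)) 1 =
      max (logHeight₁ ξ₀) 1 * ∏ p ∈ I, max (Real.log p) 1 := by
    rw [Fintype.prod_option]
    simp only [hα, Option.elim_none, Option.elim_some]
    rw [← Finset.prod_coe_sort I]
    congr 1
    exact Finset.prod_congr rfl fun p _ => by
      rw [logHeight₁_natCast_prime (prime_of_mem_bigPrimes p.2)]
  have hcastx : ((x : ℚ) : ℝ) = (u : ℝ) / v := by rw [hxdef]; push_cast; rfl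
  rw [hcard, hprod, hcastx] at key
  -- the size of the coefficients: `1 ≤ B ≤ log(uv)/log 2`
  set B : ℕ := Finset.univ.sup fun o ↦ (e o).natAbs with hB
  have huv2 : (2 : ℝ) ≤ (u : ℝ) * v := by exact_mod_cast h1
  have hlog2 : 0 < Real.log 2 := Real.log_pos (by norm_num)
  have hloguv : Real.log 2 ≤ Real.log ((u : ℝ) * v) := Real.log_le_log (by norm_num) huv2
  have hB1 : 1 ≤ B := by
    have : (e none).natAbs ≤ B := Finset.le_sup (f := fun o ↦ (e o).natAbs) (Finset.mem_univ none)
    simpa [he] using this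
  have hBle : (B : ℝ) * Real.log 2 ≤ Real.log ((u : ℝ) * v) := by
    obtain ⟨o, -, ho⟩ := Finset.exists_mem_eq_sup (Finset.univ : Finset (Option ↥I))
      Finset.univ_nonempty (fun o ↦ (e o).natAbs)
    rw [hB, ho]
    rcases o with _ | p
    · simpa [he] using hloguv
    · simp only [he, Option.elim_some]
      exact natAbs_expDiff_mul_log_two_le hu hv huv (prime_of_mem_bigPrimes p.2)
  have hBle' : (B : ℝ) ≤ Real.log ((u : ℝ) * v) / Real.log 2 := by
    rw [le_div_iff₀ hlog2]; exact hBle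
  have hQ1 : 1 ≤ Real.log ((u : ℝ) * v) / Real.log 2 := by
    rw [le_div_iff₀ hlog2, one_mul]; exact hloguv
  have hlogB : Real.log (Real.exp 1 * (B : ℝ)) ≤
      1 + Real.log (Real.log ((u : ℝ) * v) / Real.log 2) := by
    have hB0 : (0 : ℝ) < B := by exact_mod_cast hB1
    rw [Real.log_mul (Real.exp_pos 1).ne' hB0.ne', Real.log_exp]
    have := Real.log_le_log hB0 hBle'
    linarith
  -- positivity of the factors
  have hC : 0 < bwConstant (I.card + 1) 1 := bwConstant_pos (by omega) le_rfl
  have hH : 0 ≤ max (logHeight₁ ξ₀) 1 * ∏ p ∈ I, max (Real.log p) 1 :=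
    mul_nonneg (le_trans zero_le_one (le_max_right _ _))
      (Finset.prod_nonneg fun p _ => le_trans zero_le_one (le_max_right _ _))
  have hT : 0 ≤ 1 + Real.log (Real.log ((u : ℝ) * v) / Real.log 2) := by
    have := Real.log_nonneg hQ1; linarith
  set M := bwConstant (I.card + 1) 1 * (max (logHeight₁ ξ₀) 1 * ∏ p ∈ I, max (Real.log p) 1) *
    (1 + Real.log (Real.log ((u : ℝ) * v) / Real.log 2)) with hM
  have hM0 : 0 ≤ M := mul_nonneg (mul_nonneg hC.le hH) hT
  have hkeyM : -Real.log |Real.log ((u : ℝ) / v)| ≤ M := by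
    have h2 : bwConstant (I.card + 1) 1 * (max (logHeight₁ ξ₀) 1 * ∏ p ∈ I, max (Real.log p) 1) *
        Real.log (Real.exp 1 * (B : ℝ)) ≤ M :=
      mul_le_mul_of_nonneg_left hlogB (mul_nonneg hC.le hH)
    linarith
  -- from `|log x|` to `|1 - x|`
  have hxpos : (0 : ℝ) < (u : ℝ) / v := by
    have hu' : (0 : ℝ) < u := by exact_mod_cast Nat.pos_of_ne_zero hu
    have hv' : (0 : ℝ) < v := by exact_mod_cast Nat.pos_of_ne_zero hv
    positivity
  have hx1' : (u : ℝ) / v ≠ 1 := by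
    intro h
    apply hx1
    have : ((x : ℚ) : ℝ) = ((1 : ℚ) : ℝ) := by rw [hcastx, h]; push_cast; rfl
    exact_mod_cast this
  have hA := neg_log_abs_one_sub_le_of_pos hxpos hx1'
  have hmax : max 0 (-Real.log |Real.log ((u : ℝ) / v)|) ≤ M := max_le hM0 hkeyM
  linarith

end Split

/-! ### The exponential bound from Theorem 2.5 alone, and the accounting of `C(n, 1)` -/

section Accounting

variable {a b c : ℕ} {R : ℝ}

/-- `ν_p(c) ≤ ∏_{q ∣ abc} ν_q(abc)` for every prime `p ∣ c` of an abc triple. [folklore] -/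
theorem factorization_le_exponentProduct (ht : IsABCTriple a b c) {p : ℕ}
    (hp : p ∈ c.primeFactors) : c.factorization p ≤ exponentProduct (a * b * c) := by
  obtain ⟨ha0, hb0, hc0⟩ := abc_ne_zero ht
  have hab0 : a * b ≠ 0 := mul_ne_zero ha0 hb0
  have hp' : p ∈ (a * b * c).primeFactors := by
    rw [Nat.primeFactors_mul hab0 hc0]; exact Finset.mem_union_right _ hp
  rw [exponentProduct_def]
  calc c.factorization p ≤ (a * b * c).factorization p := by
        rw [Nat.factorization_mul hab0 hc0, Finsupp.add_apply]; exact Nat.le_add_left _ _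
    _ ≤ ∏ q ∈ (a * b * c).primeFactors, (a * b * c).factorization q := by
        apply Nat.le_of_dvd
        · refine Finset.prod_pos fun q hq => Nat.pos_of_ne_zero ?_
          rwa [← Finsupp.mem_support_iff, Nat.support_factorization]
        · exact Finset.dvd_prod_of_mem _ hp'

/-- `log c ≤ (∏_{p ∣ abc} ν_p(abc)) · log rad(abc)`: an abc bound from the exponents alone
(`log c = ∑_{p ∣ c} ν_p(c) log p`, each `ν_p(c)` at most the product). [folklore] -/
theorem log_le_exponentProduct_mul_log_rad (ht : IsABCTriple a b c) :
    Real.log c ≤ exponentProduct (a * b * c) * Real.log (rad a b c : ℝ) := by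
  obtain ⟨ha0, hb0, hc0⟩ := abc_ne_zero ht
  have hab0 : a * b ≠ 0 := mul_ne_zero ha0 hb0
  have hlog0 : ∀ p ∈ (a * b * c).primeFactors, 0 ≤ Real.log (p : ℝ) := fun p hp =>
    Real.log_nonneg (by exact_mod_cast (Nat.prime_of_mem_primeFactors hp).one_lt.le)
  have hsub : c.primeFactors ⊆ (a * b * c).primeFactors := by
    rw [Nat.primeFactors_mul hab0 hc0]; exact Finset.subset_union_right
  have hlogR : Real.log (rad a b c : ℝ) = ∑ p ∈ (a * b * c).primeFactors, Real.log (p : ℝ) := by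
    rw [cast_rad_eq_prod, Real.log_prod]
    intro p hp
    exact_mod_cast (Nat.prime_of_mem_primeFactors hp).ne_zero
  rw [log_eq_sum_factorization_mul_log hc0, hlogR, Finset.mul_sum]
  calc ∑ p ∈ c.primeFactors, (c.factorization p : ℝ) * Real.log p
      ≤ ∑ p ∈ c.primeFactors, (exponentProduct (a * b * c) : ℝ) * Real.log p := by
        refine Finset.sum_le_sum fun p hp => ?_
        exact mul_le_mul_of_nonneg_right (by exact_mod_cast factorization_le_exponentProduct ht hp)
          (hlog0 p (hsub hp))
    _ ≤ ∑ p ∈ (a * b * c).primeFactors, (exponentProduct (a * b * c) : ℝ) * Real.log p :=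
        Finset.sum_le_sum_of_subset_of_nonneg hsub fun p hp _ =>
          mul_nonneg (Nat.cast_nonneg _) (hlog0 p hp)

/-- The input "log of the exponents is `O(log R)`" from Theorem 2.5 ALONE (no `p`-adic linear
forms): if `∏_{p ∣ abc} ν_p(abc) ≤ k₁ R³` with `log k₁ ≤ log R` and `log R ≥ 1`, then
`log c ≤ k₁ R⁴` and so `log log c ≤ 5 log R`. [cite: Pasten2024, §4] -/
theorem loglog_le_of_exponentProduct_le (ht : IsABCTriple a b c) {k₁ : ℝ} (hk₁ : 1 ≤ k₁)
    (hE : (exponentProduct (a * b * c) : ℝ) ≤ k₁ * (rad a b c : ℝ) ^ 3)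
    (hk₁L : Real.log k₁ ≤ Real.log (rad a b c : ℝ)) :
    Real.log (Real.log c) ≤ 5 * Real.log (rad a b c : ℝ) := by
  set R : ℝ := (rad a b c : ℝ) with hRdef
  have hR1 : 1 ≤ R := one_le_rad_real a b c
  have hR : 0 < R := lt_of_lt_of_le one_pos hR1
  have hk0 : 0 < k₁ := lt_of_lt_of_le one_pos hk₁
  have hc2 : (2 : ℝ) ≤ c := by
    obtain ⟨ha, hb, habc, -⟩ := ht
    exact_mod_cast (show 2 ≤ c by omega)
  have hlogc : 0 < Real.log c := Real.log_pos (by linarith)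
  have h1 : Real.log c ≤ k₁ * R ^ 4 :=
    calc Real.log c ≤ exponentProduct (a * b * c) * Real.log R :=
          log_le_exponentProduct_mul_log_rad ht
      _ ≤ (k₁ * R ^ 3) * R :=
          mul_le_mul hE (Real.log_le_self hR.le) (Real.log_nonneg hR1) (by positivity)
      _ = k₁ * R ^ 4 := by ring
  calc Real.log (Real.log c) ≤ Real.log (k₁ * R ^ 4) := Real.log_le_log hlogc h1
    _ = Real.log k₁ + 4 * Real.log R := by
        rw [Real.log_mul hk0.ne' (by positivity), Real.log_pow]; push_cast; ring
    _ ≤ 5 * Real.log R := by linarith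

/-- The Baker–Wüstholz constant for `d = 1`: `C(n, 1) ≤ (32 (n + 1))^{2n+4}`
(`(n+1)! ≤ (n+1)^{n+1}`, `n^{n+1} ≤ (n+1)^{n+1}`, `log(2n) ≤ 2(n+1)`, `36 ≤ 32^{n+2}`).
[folklore] -/
theorem bwConstant_one_le_pow (n : ℕ) :
    bwConstant n 1 ≤ (32 * ((n : ℝ) + 1)) ^ (2 * n + 4) := by
  rw [bwConstant]
  simp only [Nat.cast_one, mul_one]
  set m : ℝ := (n : ℝ) + 1 with hm
  have hm1 : 1 ≤ m := by rw [hm]; linarith [(Nat.cast_nonneg n : (0 : ℝ) ≤ n)]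
  have hm0 : 0 ≤ m := le_trans zero_le_one hm1
  have hF : (Nat.factorial (n + 1) : ℝ) ≤ m ^ (n + 1) := by
    have h := Nat.factorial_le_pow (n + 1)
    rw [hm]
    exact_mod_cast h
  have hP : (n : ℝ) ^ (n + 1) ≤ m ^ (n + 1) :=
    pow_le_pow_left₀ (Nat.cast_nonneg n) (by rw [hm]; linarith) _
  have hLg : Real.log (2 * (n : ℝ)) ≤ 2 * m := by
    have h0 : (0 : ℝ) ≤ 2 * n := by positivity
    have := Real.log_le_self h0
    rw [hm]; linarith
  have hLg0 : 0 ≤ Real.log (2 * (n : ℝ)) := by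
    have : (2 * (n : ℝ)) = ((2 * n : ℕ) : ℝ) := by push_cast; ring
    rw [this]; exact Real.log_natCast_nonneg _
  have h36 : (36 : ℝ) ≤ 32 ^ (n + 2) :=
    calc (36 : ℝ) ≤ 32 ^ 2 := by norm_num
      _ ≤ 32 ^ (n + 2) := pow_le_pow_right₀ (by norm_num) (by omega)
  calc 18 * (Nat.factorial (n + 1) : ℝ) * (n : ℝ) ^ (n + 1) * 32 ^ (n + 2) *
        Real.log (2 * (n : ℝ))
      ≤ 18 * m ^ (n + 1) * m ^ (n + 1) * 32 ^ (n + 2) * (2 * m) := by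
        apply mul_le_mul _ hLg hLg0 (by positivity)
        apply mul_le_mul_of_nonneg_right _ (by positivity)
        exact mul_le_mul (mul_le_mul_of_nonneg_left hF (by norm_num)) hP (by positivity)
          (by positivity)
    _ = 36 * 32 ^ (n + 2) * m ^ (2 * n + 3) := by ring
    _ ≤ 32 ^ (n + 2) * 32 ^ (n + 2) * m ^ (2 * n + 4) := by
        apply mul_le_mul _ (pow_le_pow_right₀ hm1 (by omega)) (by positivity) (by positivity)
        exact mul_le_mul_of_nonneg_right h36 (by positivity)
    _ = (32 * m) ^ (2 * n + 4) := by ring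

/-- `log 32 ≤ 4` and `log 6 ≤ 2`. [folklore] -/
theorem log_thirtyTwo_le_and_log_six_le : Real.log 32 ≤ 4 ∧ Real.log 6 ≤ 2 := by
  have h2 := Real.log_two_lt_d9
  have h32 : Real.log 32 = 5 * Real.log 2 := by
    rw [show (32 : ℝ) = 2 ^ 5 by norm_num, Real.log_pow]; push_cast; ring
  have h6 : Real.log 6 ≤ 2 := by
    rw [Real.log_le_iff_le_exp (by norm_num)]
    have he := Real.exp_one_gt_d9
    have : Real.exp 2 = Real.exp 1 * Real.exp 1 := by rw [← Real.exp_add]; norm_num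
    nlinarith
  constructor <;> linarith

/-- `s(R) ≤ log R` (as `log₂ R ≤ log R`). [folklore] -/
theorem sfun_le_log (hL : Real.exp 1 ≤ Real.log R) : sfun R ≤ Real.log R := by
  have hL0 : 0 ≤ Real.log R := le_trans zero_le_one (one_le_log_of_exp_le hL)
  rw [sfun_def]
  calc Real.sqrt (Real.log R * Real.log (Real.log R))
      ≤ Real.sqrt (Real.log R * Real.log R) :=
        Real.sqrt_le_sqrt (mul_le_mul_of_nonneg_left (Real.log_le_self hL0) hL0)
    _ = Real.log R := Real.sqrt_mul_self hL0

/-- The accounting of the Baker–Wüstholz constant: if `k · s(R) ≤ 4 log R` and `log R ≥ e`, then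
`log C(k+1, 1) ≤ 98 · s(R)` — i.e. `C(n, 1) = exp(O(n log n))` is sub-exponential in
`√((log R) log₂ R)` for `n − 1 ≤ 4 √(log R / log₂ R)`; Matveev's sharpening `c^n` of the
dependence on `n` is not needed for Theorem 1.4 (1). [folklore] -/
theorem log_bwConstant_le (hL : Real.exp 1 ≤ Real.log R) {k : ℕ}
    (hk : (k : ℝ) * sfun R ≤ 4 * Real.log R) :
    Real.log (bwConstant (k + 1) 1) ≤ 98 * sfun R := by
  have hL1 := one_le_log_of_exp_le hL
  have hL0 : 0 ≤ Real.log R := le_trans zero_le_one hL1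
  have hℓ1 := one_le_loglog hL
  have hs1 := one_le_sfun hL
  have hs := sfun_pos hL
  have hsL := sfun_le_log hL
  have hsq := sfun_sq hL
  obtain ⟨h32, h6⟩ := log_thirtyTwo_le_and_log_six_le
  have hk0 : (0 : ℝ) ≤ k := Nat.cast_nonneg k
  have hC : 0 < bwConstant (k + 1) 1 := bwConstant_pos (by omega) le_rfl
  -- `C ≤ (32 (k+2))^{2k+6}`
  have h1 : Real.log (bwConstant (k + 1) 1) ≤
      (2 * k + 6 : ℝ) * (Real.log 32 + Real.log ((k : ℝ) + 2)) := by
    have h := bwConstant_one_le_pow (k + 1)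
    have hk2 : (0 : ℝ) < (k : ℝ) + 2 := by linarith
    have hcast : ((k + 1 : ℕ) : ℝ) + 1 = (k : ℝ) + 2 := by push_cast; ring
    rw [hcast] at h
    calc Real.log (bwConstant (k + 1) 1)
        ≤ Real.log ((32 * ((k : ℝ) + 2)) ^ (2 * (k + 1) + 4)) := Real.log_le_log hC h
      _ = (2 * (k + 1) + 4 : ℕ) * (Real.log 32 + Real.log ((k : ℝ) + 2)) := by
          rw [Real.log_pow, Real.log_mul (by norm_num) hk2.ne']
      _ = (2 * k + 6 : ℝ) * (Real.log 32 + Real.log ((k : ℝ) + 2)) := by push_cast; ring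
  -- `log (k+2) ≤ log (6 log R) = log 6 + log₂ R ≤ 2 + log₂ R`
  have h2 : Real.log ((k : ℝ) + 2) ≤ 2 + Real.log (Real.log R) := by
    have hk2s : (k : ℝ) + 2 ≤ 6 * Real.log R := by
      calc (k : ℝ) + 2 ≤ ((k : ℝ) + 2) * sfun R := le_mul_of_one_le_right (by linarith) hs1
        _ = (k : ℝ) * sfun R + 2 * sfun R := by ring
        _ ≤ 4 * Real.log R + 2 * Real.log R := by linarith
        _ = 6 * Real.log R := by ring
    have hLpos : 0 < Real.log R := by linarith
    calc Real.log ((k : ℝ) + 2) ≤ Real.log (6 * Real.log R) := Real.log_le_log (by linarith) hk2s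
      _ = Real.log 6 + Real.log (Real.log R) := Real.log_mul (by norm_num) hLpos.ne'
      _ ≤ 2 + Real.log (Real.log R) := by linarith
  -- `log 32 + log (k+2) ≤ 7 log₂ R`
  have h3 : Real.log 32 + Real.log ((k : ℝ) + 2) ≤ 7 * Real.log (Real.log R) := by linarith
  -- `(2k+6) log₂ R ≤ 14 s`: multiply by `s` and use `s² = (log R) log₂ R`, `s ≤ log R`
  have h4 : (2 * k + 6 : ℝ) * Real.log (Real.log R) ≤ 14 * sfun R := by
    refine le_of_mul_le_mul_right ?_ hs
    have hℓ0 : 0 ≤ Real.log (Real.log R) := le_trans zero_le_one hℓ1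
    calc (2 * k + 6 : ℝ) * Real.log (Real.log R) * sfun R
        = ((2 * k + 6 : ℝ) * sfun R) * Real.log (Real.log R) := by ring
      _ ≤ (14 * Real.log R) * Real.log (Real.log R) := by
          apply mul_le_mul_of_nonneg_right _ hℓ0
          nlinarith
      _ = 14 * sfun R * sfun R := by rw [mul_assoc 14 (sfun R), ← sq, hsq]; ring
  have h26 : (0 : ℝ) ≤ 2 * k + 6 := by positivity
  calc Real.log (bwConstant (k + 1) 1)
      ≤ (2 * k + 6 : ℝ) * (Real.log 32 + Real.log ((k : ℝ) + 2)) := h1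
    _ ≤ (2 * k + 6 : ℝ) * (7 * Real.log (Real.log R)) := mul_le_mul_of_nonneg_left h3 h26
    _ = 7 * ((2 * k + 6 : ℝ) * Real.log (Real.log R)) := by ring
    _ ≤ 7 * (14 * sfun R) := by linarith
    _ = 98 * sfun R := by ring

end Accounting

/-! ### Assembly: Theorem 1.4 (1) from Baker–Wüstholz and Theorem 2.5 -/

section Assembly

variable {a b c : ℕ}

/-- Step 3 of §4 for the Baker–Wüstholz heights: with `N = ⌊B⌋`, `B = exp s(R)`,
`max(h(ξ₀), 1) · ∏_{p ∈ I} max(log p, 1) ≤ B · log R · (log R)^{#I}` (`h(ξ₀) ≤ B log R`,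
`log p ≤ log R`, `1 ≤ log R`). [cite: Pasten2024, §4] -/
theorem bwHeights_le (ht : IsABCTriple a b c) (hL : Real.exp 1 ≤ Real.log (rad a b c : ℝ)) :
    max (logHeight₁ (cofactor b c ⌊Real.exp (sfun (rad a b c : ℝ))⌋₊)) 1 *
        ∏ p ∈ bigPrimes b c ⌊Real.exp (sfun (rad a b c : ℝ))⌋₊, max (Real.log p) 1 ≤
      Real.exp (sfun (rad a b c : ℝ)) * Real.log (rad a b c : ℝ) *
        Real.log (rad a b c : ℝ) ^ (bigPrimes b c ⌊Real.exp (sfun (rad a b c : ℝ))⌋₊).card := by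
  obtain ⟨ha0, hb0, hc0⟩ := abc_ne_zero ht
  set R : ℝ := (rad a b c : ℝ) with hRdef
  set s := sfun R with hsdef
  set N := ⌊Real.exp s⌋₊ with hNdef
  set I := bigPrimes b c N with hIdef
  have hL1 := one_le_log_of_exp_le hL
  have hrad : (UniqueFactorizationMonoid.radical (b * c * a) : ℕ) = rad a b c := radical_bca a b c
  have hξ₀ : logHeight₁ (cofactor b c N) ≤ Real.exp s * Real.log R := by
    have h1 := logHeight₁_cofactor_le b c N
    have hprodpos : 0 < ∏ p ∈ (b * c).primeFactors, (p : ℝ) :=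
      Finset.prod_pos fun p hp => by exact_mod_cast (Nat.prime_of_mem_primeFactors hp).pos
    have h2 : Real.log (∏ p ∈ (b * c).primeFactors, (p : ℝ)) ≤ Real.log R := by
      apply Real.log_le_log hprodpos
      have h3 := prod_primeFactors_le_radical hb0 hc0 ha0
      rw [hrad] at h3
      exact h3
    have hN : (N : ℝ) ≤ Real.exp s := Nat.floor_le (Real.exp_pos s).le
    calc logHeight₁ (cofactor b c N)
        ≤ N * Real.log (∏ p ∈ (b * c).primeFactors, (p : ℝ)) := h1
      _ ≤ N * Real.log R := mul_le_mul_of_nonneg_left h2 (Nat.cast_nonneg N)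
      _ ≤ Real.exp s * Real.log R := mul_le_mul_of_nonneg_right hN (by linarith)
  have hmax : max (logHeight₁ (cofactor b c N)) 1 ≤ Real.exp s * Real.log R := by
    refine max_le hξ₀ ?_
    have h1 : (1 : ℝ) ≤ Real.exp s := Real.one_le_exp (sfun_pos hL).le
    nlinarith
  have hprod : ∏ p ∈ I, max (Real.log p) 1 ≤ Real.log R ^ I.card := by
    rw [← Finset.prod_const]
    refine Finset.prod_le_prod (fun p _ => le_trans zero_le_one (le_max_right _ _)) fun p hp => ?_
    refine max_le ?_ hL1
    have hple : (p : ℝ) ≤ R := by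
      have h := le_radical_of_mem_bigPrimes hb0 hc0 ha0 hp
      rw [hrad] at h
      rw [hRdef]
      exact_mod_cast h
    exact Real.log_le_log (by exact_mod_cast (prime_of_mem_bigPrimes hp).pos) hple
  exact mul_le_mul hmax hprod
    (Finset.prod_nonneg fun p _ => le_trans zero_le_one (le_max_right _ _)) (by positivity)

/-- Step 5 of §4 for the Baker–Wüstholz coefficient term: `B ≤ log(bc)/log 2 ≤ 4 log c`, so
`1 + log(log(bc)/log 2) ≤ 3 + log log c ≤ 8 log R` by `loglog_le_of_exponentProduct_le`
(Theorem 2.5). [cite: Pasten2024, §4] -/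
theorem coeffTerm_le (ht : IsABCTriple a b c) {k₁ : ℝ} (hk₁ : 1 ≤ k₁)
    (hE : (exponentProduct (a * b * c) : ℝ) ≤ k₁ * (rad a b c : ℝ) ^ 3)
    (hk₁L : Real.log k₁ ≤ Real.log (rad a b c : ℝ)) (hL1 : 1 ≤ Real.log (rad a b c : ℝ)) :
    1 + Real.log (Real.log ((b : ℝ) * c) / Real.log 2) ≤ 8 * Real.log (rad a b c : ℝ) := by
  have ⟨ha, hb, habc, _⟩ := ht
  have hc2 : (2 : ℝ) ≤ c := by exact_mod_cast (show 2 ≤ c by omega)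
  have hb1 : (1 : ℝ) ≤ b := by exact_mod_cast hb
  have hbc : (b : ℝ) ≤ c := by exact_mod_cast (show b ≤ c by omega)
  have hlogc : 0 < Real.log c := Real.log_pos (by linarith)
  have hlog2 := Real.log_two_gt_d9
  have h1 : Real.log ((b : ℝ) * c) ≤ 2 * Real.log c := by
    rw [Real.log_mul (by linarith) (by linarith)]
    have := Real.log_le_log (by linarith) hbc
    linarith
  have h2 : Real.log ((b : ℝ) * c) / Real.log 2 ≤ 4 * Real.log c := by
    rw [div_le_iff₀ (by linarith)]
    nlinarith
  have hpos : 0 < Real.log ((b : ℝ) * c) / Real.log 2 := by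
    apply div_pos _ (by linarith)
    exact Real.log_pos (by nlinarith)
  have h3 : Real.log (Real.log ((b : ℝ) * c) / Real.log 2) ≤
      Real.log 4 + Real.log (Real.log c) := by
    rw [← Real.log_mul (by norm_num) hlogc.ne']
    exact Real.log_le_log hpos h2
  have h4 : Real.log 4 ≤ 2 := by
    rw [show (4 : ℝ) = 2 ^ 2 by norm_num, Real.log_pow]; push_cast
    linarith [Real.log_two_lt_d9]
  have h5 := loglog_le_of_exponentProduct_le ht hk₁ hE hk₁L
  linarith

/-- **Pasten's Theorem 1.4 (1) from Baker–Wüstholz 1993 and Theorem 2.5.** The statement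
`pasten2024_thm_1_4_1` follows from the two named facts `baker_wustholz ℚ` (Baker–Wüstholz,
Crelle 442 (1993), Theorem = BW 2007 Thm 7.1, over `K = ℚ`: the ARCHIMEDEAN lower bound for
linear forms in logarithms with `C(n, 1) = 18 (n+1)! n^{n+1} 32^{n+2} log(2n)`) and
`pasten2024_thm_2_5` (Shimura curves), with `κ = 113` and threshold `log R ≥ max(e, log k₁)`.
Compared with the printed proof (§4: Theorem 2.1 (i) = Evertse–Győry Thm 4.2.1 from Matveev
and Yu; Theorem 2.5; an exponential abc bound), two inputs are weakened: (a) Matveev's `K^m`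
is replaced by Baker–Wüstholz's `C(m, 1) = exp(O(m log m))`, still `exp(O(s))` for
`m ≤ 4√(log R / log₂ R) + 1` (`log_bwConstant_le`); (b) the exponential abc bound (hence all
`p`-adic theory) is replaced by `log c ≤ (∏ ν_p(abc)) log R ≤ k₁ R⁴`, a consequence of
Theorem 2.5 itself (`loglog_le_of_exponentProduct_le`). The architecture (splitting of `b/c` at
`B = exp s(R)`, `#I · s ≤ 4 log R` from Theorem 2.5, `h(ξ₀) ≤ B log R`) is that of §4.
[cite: Pasten2024, Theorem 1.4 (1) and §4] [cite: BakerWustholz2007, Thm 7.1] -/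
theorem pasten2024_thm_1_4_1_of_bakerWustholz (hBW : baker_wustholz ℚ)
    (h25 : pasten2024_thm_2_5) : pasten2024_thm_1_4_1 := by
  obtain ⟨κ₁, hκ₁⟩ := h25 (1 / 3) (by norm_num)
  set k₁ : ℝ := max κ₁ 1 with hk₁def
  set L₀ : ℝ := max (Real.exp 1) (Real.log k₁) with hL₀def
  have hk₁ : 1 ≤ k₁ := le_max_right _ _
  refine ⟨113, by norm_num, Real.exp L₀, ?_⟩
  intro a b c ht hR₀ η hη haη
  show Real.log c ≤ η⁻¹ * Real.exp (113 * sfun (rad a b c : ℝ))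
  set R : ℝ := (rad a b c : ℝ) with hRdef
  have hR1 : 1 ≤ R := one_le_rad_real a b c
  have hR : 0 < R := lt_of_lt_of_le one_pos hR1
  have hL₀L : L₀ ≤ Real.log R := (Real.le_log_iff_exp_le hR).mpr hR₀
  have hL : Real.exp 1 ≤ Real.log R := le_trans (le_max_left _ _) hL₀L
  have hk₁L : Real.log k₁ ≤ Real.log R := le_trans (le_max_right _ _) hL₀L
  have hL1 := one_le_log_of_exp_le hL
  have hL0 : 0 ≤ Real.log R := le_trans zero_le_one hL1
  set s := sfun R with hsdef
  have hs := sfun_pos hL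
  have hs1 := one_le_sfun hL
  set N := ⌊Real.exp s⌋₊ with hNdef
  obtain ⟨ha0, hb0, hc0⟩ := abc_ne_zero ht
  obtain ⟨hbc, -, h1bc⟩ := abc_coprime_aux ht
  -- Step 1: `η log c ≤ −log |1 − b/c|`
  have step1 : η * Real.log c ≤ -Real.log |1 - (b : ℝ) / c| := eta_mul_log_le ht haη
  -- Step 2: Baker–Wüstholz on the splitting of `b/c`
  have step2 := neg_log_abs_one_sub_div_le_of_bakerWustholz hBW hb0 hc0 hbc h1bc N
  set n := (bigPrimes b c N).card with hndef
  set C := bwConstant (n + 1) 1 with hCdef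
  set H := max (logHeight₁ (cofactor b c N)) 1 *
    ∏ p ∈ bigPrimes b c N, max (Real.log p) 1 with hHdef
  set T := 1 + Real.log (Real.log ((b : ℝ) * c) / Real.log 2) with hTdef
  -- Step 3: `H ≤ B (log R) (log R)^n`
  have step3 : H ≤ Real.exp s * Real.log R * Real.log R ^ n := bwHeights_le ht hL
  -- Step 4: `n s ≤ 4 log R` (Theorem 2.5), hence `(log R)^n ≤ exp(4 s)`
  have hE : (exponentProduct (a * b * c) : ℝ) ≤ k₁ * R ^ 3 := by
    have h := hκ₁ a b c ht
    have h3 : R ^ (8 / 3 + 1 / 3 : ℝ) = R ^ 3 := by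
      rw [show (8 / 3 + 1 / 3 : ℝ) = ((3 : ℕ) : ℝ) by norm_num, Real.rpow_natCast]
    rw [h3] at h
    exact h.trans (mul_le_mul_of_nonneg_right (le_max_left _ _) (by positivity))
  have step4a : (n : ℝ) * s ≤ 4 * Real.log R := card_bigPrimes_mul_sfun_le ht hk₁ hE hk₁L
  have step4 : Real.log R ^ n ≤ Real.exp (4 * s) := by
    have h := mul_log_pow_le_exp le_rfl hL step4a
    simpa [Real.log_one] using h
  -- Step 5: `C(n+1, 1) ≤ exp(98 s)`
  have hC : 0 < C := bwConstant_pos (by omega) le_rfl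
  have step5 : C ≤ Real.exp (98 * s) := by
    have h := log_bwConstant_le hL step4a
    calc C = Real.exp (Real.log C) := (Real.exp_log hC).symm
      _ ≤ Real.exp (98 * s) := Real.exp_le_exp.mpr h
  -- Step 6: `T ≤ 8 log R ≤ 8 B`
  have hLB : Real.log R ≤ Real.exp s := log_le_exp_sfun hL
  have step6 : T ≤ 8 * Real.exp s :=
    (coeffTerm_le ht hk₁ hE hk₁L hL1).trans (by linarith)
  -- nonnegativity
  have hH0 : 0 ≤ H := mul_nonneg (le_trans zero_le_one (le_max_right _ _))
    (Finset.prod_nonneg fun p _ => le_trans zero_le_one (le_max_right _ _))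
  have hT0 : 0 ≤ T := by
    have hbc2 : (2 : ℝ) ≤ (b : ℝ) * c := by exact_mod_cast h1bc
    have hlog2 : 0 < Real.log 2 := Real.log_pos (by norm_num)
    have hQ1 : 1 ≤ Real.log ((b : ℝ) * c) / Real.log 2 := by
      rw [le_div_iff₀ hlog2, one_mul]
      exact Real.log_le_log (by norm_num) hbc2
    have := Real.log_nonneg hQ1
    rw [hTdef]; linarith
  -- combine
  have main : η * Real.log c ≤ Real.exp (113 * s) :=
    calc η * Real.log c ≤ 1 + C * H * T := step1.trans step2
      _ ≤ 1 + Real.exp (98 * s) * (Real.exp s * Real.log R * Real.log R ^ n) *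
            (8 * Real.exp s) := by
          have := mul_le_mul (mul_le_mul step5 step3 hH0 (by positivity)) step6 hT0
            (by positivity)
          linarith
      _ ≤ 1 + Real.exp (98 * s) * (Real.exp s * Real.exp s * Real.exp (4 * s)) *
            (8 * Real.exp s) := by
          have h1 : Real.exp s * Real.log R * Real.log R ^ n ≤
              Real.exp s * Real.exp s * Real.exp (4 * s) :=
            mul_le_mul (mul_le_mul_of_nonneg_left hLB (by positivity)) step4 (by positivity)
              (by positivity)
          have h2 := mul_le_mul_of_nonneg_left h1 (Real.exp_pos (98 * s)).le
          have h3 := mul_le_mul_of_nonneg_right h2 (show (0 : ℝ) ≤ 8 * Real.exp s by positivity)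
          linarith
      _ = 1 + 8 * Real.exp (105 * s) := by
          have : Real.exp (105 * s) =
              Real.exp (98 * s) * (Real.exp s * Real.exp s * Real.exp (4 * s)) * Real.exp s := by
            simp only [← Real.exp_add]; congr 1; ring
          rw [this]; ring
      _ ≤ 9 * Real.exp (105 * s) := by
          linarith [Real.one_le_exp (show (0 : ℝ) ≤ 105 * s by positivity)]
      _ ≤ Real.exp (8 * s) * Real.exp (105 * s) := by
          apply mul_le_mul_of_nonneg_right _ (by positivity)
          linarith [Real.add_one_le_exp (8 * s)]
      _ = Real.exp (113 * s) := by rw [← Real.exp_add]; congr 1; ring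
  calc Real.log c = η⁻¹ * (η * Real.log c) := by field_simp
    _ ≤ η⁻¹ * Real.exp (113 * s) := mul_le_mul_of_nonneg_left main (inv_pos.mpr hη).le

end Assembly

end Literature.Barriers.ABC

end
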